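import Literature.NumberTheory.Sieve.QuadraticRootsPrimeModuliToth
import Literature.NumberTheory.Sieve.QuadraticRootsPrimeModuliDFILinear
import Literature.NumberTheory.Sieve.QuadraticRootsPrimeModuliDFIProofs
import HarnessLib

/-!
# Tóth 2000 (positive discriminant), II: hypothesis (34) from a linear-form bound of any power-saving shape (PROVED)

Topic `Literature/NumberTheory/Sieve`, second companion of the named fact
`Literature.NumberTheory.Sieve.toth2000_quadraticRoots_primeModuli` (`PolynomialCongruencesPrimeModuli.lean`;
Á. Tóth, *Roots of quadratic congruences*, IMRN 2000:14, 719–739): for every irreducible quadratic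
`f ∈ ℤ[X]` of positive discriminant and every `h ≠ 0`, `∑_{p ≤ x} ρ_h(p) = o(π(x))`,
`ρ_h(n) = ∑_{f(ν) ≡ 0 (mod n)} e(hν/n) = polyRootWeylSum f n h`.

The first companion (`QuadraticRootsPrimeModuliToth.lean`) reduced the fact to DFI's sieve theorem
[cite: DukeFriedlanderIwaniec1995, Theorem 5 p. 437] and the two hypotheses (34), (35) of that
theorem for `c_n = ρ_h(n)` (`DFI1995.Hyp34`, `DFI1995.Hyp35`).  Theorem 5 has since been PROVED
(`dukeFriedlanderIwaniec1995_theorem5_holds`, `QuadraticRootsPrimeModuliDFIProofs.lean`), so the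
reduction no longer depends on it (`toth2000_quadraticRoots_primeModuli_of_hyp34_hyp35`,
`PolynomialCongruencesPrimeModuliProofs.lean`).

The analytic heart of Tóth's paper is the linear-form estimate which feeds (34): in the notation
`𝒲_h(x, N) = ∑_{x < n < 2x, N ∣ n} ρ_h(n)` it reads, for every sufficiently large natural `L`,
`𝒲_h(x, N) ≪_h (N²/x)^{1/(4L)} (x/N)^{1+1/L²}` [cite: Ngo2024, §1 (1.3), restating Toth2000], to be
compared with DFI's `𝒲_h(x, N) ≪_ε (h,N)^{1/20} (N²/x)^{1/20} (x/N)^{1+ε}` for negative discriminant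
[cite: DukeFriedlanderIwaniec1995, Proposition 1 (9)] = [cite: Ngo2024, (1.2)] and with Ngo's
improvement `𝒲_h(x, N) ≪_ε (x^{12/13} N^{−11/13} h^{1/13} + h) x^ε` for positive discriminant
[cite: Ngo2024, Theorem 1.1 (1.4)].  With `N = d`, `x = dM` these are bounds for DFI's
`L_d(M) = ∑_{M < m ≤ 2M} ρ_h(dm)` (`DFI1995.linearForm f h d M`) of the common shape
`|L_d(M)| ≤ K d^θ M^{1−θ+η}` (`1 ≤ d ≤ M`), with `(θ, η) = (1/20, ε')`, `(1/(4L), 1/L²)`,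
`(1/13 + ε', 2ε')` respectively.  The deduction "(34) follows from Proposition 1" of
[cite: DukeFriedlanderIwaniec1995, §7 p. 438] — carried out for DFI's shape and `f = aX² + 2bX + c`
in `QuadraticRootsPrimeModuliDFILinear.lean` — works for any such shape as soon as the saving beats
the loss at level `D = x^{1/2−ε}`, i.e. `η < 2εθ`: the dyadic blocks contribute
`≪ K x^{1−θ+η} D^{2θ} (log x)² = K x^{1+η−2εθ} (log x)²` and the initial segments `m < 2d`
contribute `≪ C_f D² (log x)² = C_f x^{1−2ε} (log x)²`.  This file PROVES that parametric
deduction for a general `f ∈ ℤ[X]` with `|ρ_h(n)| ≤ C τ(n)` (no new named fact is introduced;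
Tóth's and Ngo's bounds enter only as HYPOTHESES of the corollaries, in the shapes printed in
[cite: Ngo2024, (1.3), (1.4)]):

* `DFI1995.hyp34_of_linearFormBound` — `|L_d(M)| ≤ K d^θ M^{1−θ+η}` for `1 ≤ d ≤ M`, `0 < θ ≤ 1`,
  `0 ≤ η < 2εθ`, `0 < ε ≤ 1/2` ⇒ `DFI1995.Hyp34 f h ε`;
* `DFI1995.hyp34_of_linearFormBound_toth` — the shape of Tóth's bound (all large `L`) ⇒ (34) for
  every `0 < ε ≤ 1/2` (take `L > 2/ε`);
* `DFI1995.hyp34_of_linearFormBound_ngo` — the shape of Ngo's Theorem 1.1 (`h` fixed) ⇒ (34);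
* `DFI1995.hyp34_of_linearFormBound_dfi` — DFI's shape `K d^{1/20} M^{19/20+ε'}` (all `ε' > 0`) ⇒ (34)
  for a general `f` (the case `f = aX² + 2bX + c` being `DFI1995.hyp34_of_proposition1`);
* `toth2000_quadraticRoots_primeModuli_of_tothLinearFormBound_of_hyp35` — Tóth's theorem from a
  Tóth-shaped linear-form bound for every irreducible quadratic of positive discriminant and every
  `h ≥ 1`, together with (35).

So the trust base of a future discharge along the printed lines is now: Tóth's linear-form bound
(for (34), via this file) and the bilinear-form input for (35) (Tóth's analogue of
[cite: DukeFriedlanderIwaniec1995, Proposition 2], obtained in the paper from the smoothed linear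
forms by Cauchy's inequality as in DFI §5), both resting on the spectral theory of Poincaré series
for `Γ₀(q)` attached to indefinite binary quadratic forms (closed geodesics), which is not in
Mathlib.  The paper [Toth2000] itself is not held (paywalled, acquisition requested); the shapes
used here are those printed in [Ngo2024].

## References

* Á. Tóth, *Roots of quadratic congruences*, Internat. Math. Res. Notices 2000, no. 14, 719–739.
  [cite: Toth2000, main theorem]
* H. T. Ngo, *On roots of quadratic congruences*, Bull. Lond. Math. Soc. 56 (2024) 2886–2910
  (arXiv:2107.13301), §1: (1.2) (DFI's bound), (1.3) (Tóth's bound), Theorem 1.1 (1.4)–(1.5).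
  [cite: Ngo2024, §1 (1.2)–(1.5)]
* W. Duke, J. B. Friedlander, H. Iwaniec, *Equidistribution of roots of a quadratic congruence to
  prime moduli*, Ann. of Math. (2) 141 (1995), 423–441: Proposition 1 (9), (32), (34), Theorem 5
  (p. 437), §7 (p. 438). [cite: DukeFriedlanderIwaniec1995, §7]
-/

namespace Literature.NumberTheory.Sieve

open scoped BigOperators Polynomial
open Filter Asymptotics Finset Polynomial

namespace DFI1995

/-! ### The dyadic bookkeeping for a general shape `K d^θ M^e` -/

/-- The summand of the dyadic part: `d^θ (x/d)^{1−θ+η} ≤ x^{1−θ+η} D^{2θ} / d` for `1 ≤ d ≤ D`,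
`θ, η ≥ 0`. [folklore] -/
theorem rpow_mul_div_rpow_le_of_exponents {d D x θ η : ℝ} (hd : 1 ≤ d) (hdD : d ≤ D) (hx : 0 < x)
    (hθ : 0 ≤ θ) (hη : 0 ≤ η) :
    d ^ θ * (x / d) ^ (1 - θ + η) ≤ x ^ (1 - θ + η) * D ^ (2 * θ) / d := by
  have hd0 : 0 < d := by linarith
  have hD0 : 0 ≤ D := by linarith
  rw [Real.div_rpow hx.le hd0.le, mul_div_assoc', mul_comm (d ^ θ), mul_div_assoc, mul_div_assoc]
  refine mul_le_mul_of_nonneg_left ?_ (by positivity)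
  rw [div_eq_mul_inv, ← Real.rpow_neg hd0.le, ← Real.rpow_add hd0,
    show (θ + -(1 - θ + η) : ℝ) = (2 * θ - 1) - η by ring]
  calc d ^ ((2 * θ - 1) - η) ≤ d ^ (2 * θ - 1) :=
        Real.rpow_le_rpow_of_exponent_le hd (by linarith)
    _ = d ^ (2 * θ) * d ^ (-1 : ℝ) := by
        rw [show (2 * θ - 1 : ℝ) = 2 * θ + (-1) by ring, Real.rpow_add hd0]
    _ ≤ D ^ (2 * θ) * d ^ (-1 : ℝ) :=
        mul_le_mul_of_nonneg_right (Real.rpow_le_rpow hd0.le hdD (by linarith))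
          (Real.rpow_nonneg hd0.le _)
    _ = D ^ (2 * θ) / d := by
        rw [Real.rpow_neg_one]; ring

/-- **The inner sum over `m ≤ x/d`, general shape**: if `|L_d(M)| ≤ K d^θ M^e` for all `M ≥ d`
(`e ≥ 0`) and `|ρ_h(n)| ≤ C τ(n)`, then
`|S_d(⌊x⌋/d)| ≤ C τ(d) · 2d (1 + log 2d) + log₂⌊x⌋ · K d^θ (x/d)^e` (trivial bound below `2d`,
the hypothesis on the `≤ log₂ x` dyadic blocks above; the argument of
`DFI1995.norm_partialSum_floor_div_le`, which is the case `θ = 1/20`, `e = 19/20 + ε`). [folklore] -/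
theorem norm_partialSum_floor_div_le_of_exponents {f : ℤ[X]} {h : ℤ} {C K θ e : ℝ} (hC : 0 ≤ C)
    (hK : 0 ≤ K) (he : 0 ≤ e)
    (hρ : ∀ n : ℕ, 1 ≤ n → ‖polyRootWeylSum f n h‖ ≤ C * (Nat.divisors n).card)
    (hL : ∀ d : ℕ, 1 ≤ d → ∀ M : ℝ, (d : ℝ) ≤ M →
      ‖linearForm f h d M‖ ≤ K * (d : ℝ) ^ θ * M ^ e)
    {d : ℕ} (hd : 1 ≤ d) {x : ℝ} (hx : 1 ≤ x) :
    ‖partialSum f h d ((⌊x⌋₊ / d : ℕ) : ℝ)‖ ≤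
      C * (Nat.divisors d).card * ((2 * d : ℕ) * (1 + Real.log (2 * d : ℕ))) +
        (Nat.log 2 ⌊x⌋₊ : ℝ) * (K * (d : ℝ) ^ θ * (x / d) ^ e) := by
  set n : ℕ := ⌊x⌋₊ / d with hn
  set q : ℕ := n / d with hq
  set J : ℕ := Nat.log 2 q with hJ
  have hd0 : (0 : ℝ) < d := by exact_mod_cast hd
  have hX0 : (0 : ℝ) ≤ n := Nat.cast_nonneg _
  rw [partialSum_eq_dyadic f h d hX0 J]
  -- the leftover `m ≤ n/2^J < 2d`
  have hnlt : (n : ℝ) < d * (2 * 2 ^ J) := by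
    have h1 : n < d * (q + 1) := by
      have := Nat.div_add_mod n d
      have hmod := Nat.mod_lt n (show 0 < d by omega)
      rw [hq]; nlinarith
    have h2 : q + 1 ≤ 2 * 2 ^ J := by
      have := Nat.lt_pow_succ_log_self (b := 2) one_lt_two q
      rw [← hJ, pow_succ] at this; omega
    calc (n : ℝ) < (d * (q + 1) : ℕ) := by exact_mod_cast h1
      _ ≤ (d * (2 * 2 ^ J) : ℕ) := by exact_mod_cast Nat.mul_le_mul_left d h2
      _ = d * (2 * 2 ^ J) := by push_cast; ring
  have hleft_floor : ⌊(n : ℝ) / 2 ^ J⌋₊ ≤ 2 * d := by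
    refine Nat.floor_le_of_le ?_
    rw [div_le_iff₀ (by positivity)]
    push_cast
    linarith
  have hleft := norm_partialSum_le hC hρ hd ((n : ℝ) / 2 ^ J) hleft_floor
  -- the dyadic blocks
  have hJle : J ≤ Nat.log 2 ⌊x⌋₊ := by
    refine Nat.log_mono_right ((Nat.div_le_self _ _).trans (Nat.div_le_self _ _))
  have hnle : (n : ℝ) ≤ x / d := by
    calc (n : ℝ) ≤ (⌊x⌋₊ : ℝ) / d := Nat.cast_div_le
      _ ≤ x / d := by gcongr; exact Nat.floor_le (by linarith)
  have hblock : ∀ j ∈ Finset.range J,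
      ‖linearForm f h d ((n : ℝ) / 2 ^ (j + 1))‖ ≤ K * (d : ℝ) ^ θ * (x / d) ^ e := by
    intro j hj
    rw [Finset.mem_range] at hj
    have hJ1 : 1 ≤ J := by omega
    have hq0 : q ≠ 0 := by
      intro h0
      rw [hJ, h0, Nat.log_zero_right] at hJ1
      exact absurd hJ1 (by norm_num)
    have hpow : 2 ^ (j + 1) ≤ q := by
      have h1 : 2 ^ (j + 1) ≤ 2 ^ J := Nat.pow_le_pow_right (by norm_num) hj
      have h2 : 2 ^ J ≤ q := by rw [hJ]; exact Nat.pow_log_le_self 2 hq0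
      exact h1.trans h2
    have hdM : (d : ℝ) ≤ (n : ℝ) / 2 ^ (j + 1) := by
      rw [le_div_iff₀ (by positivity)]
      have : d * 2 ^ (j + 1) ≤ n := by
        calc d * 2 ^ (j + 1) ≤ d * q := Nat.mul_le_mul_left d hpow
          _ = n / d * d := by rw [hq, mul_comm]
          _ ≤ n := Nat.div_mul_le_self n d
      exact_mod_cast this
    refine (hL d hd _ hdM).trans ?_
    refine mul_le_mul_of_nonneg_left ?_ (by positivity)
    refine Real.rpow_le_rpow (by positivity) ?_ he
    calc (n : ℝ) / 2 ^ (j + 1) ≤ n := by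
          rw [div_le_iff₀ (by positivity)]
          have : (1 : ℝ) ≤ 2 ^ (j + 1) := one_le_pow₀ (by norm_num)
          nlinarith
      _ ≤ x / d := hnle
  calc ‖partialSum f h d ((n : ℝ) / 2 ^ J) + ∑ j ∈ Finset.range J, linearForm f h d ((n : ℝ) / 2 ^ (j + 1))‖
      ≤ ‖partialSum f h d ((n : ℝ) / 2 ^ J)‖ + ∑ j ∈ Finset.range J, ‖linearForm f h d ((n : ℝ) / 2 ^ (j + 1))‖ :=
        (norm_add_le _ _).trans (by gcongr; exact norm_sum_le _ _)
    _ ≤ C * (Nat.divisors d).card * ((2 * d : ℕ) * (1 + Real.log (2 * d : ℕ))) +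
        ∑ j ∈ Finset.range J, K * (d : ℝ) ^ θ * (x / d) ^ e :=
        add_le_add hleft (Finset.sum_le_sum hblock)
    _ ≤ C * (Nat.divisors d).card * ((2 * d : ℕ) * (1 + Real.log (2 * d : ℕ))) +
        (Nat.log 2 ⌊x⌋₊ : ℝ) * (K * (d : ℝ) ^ θ * (x / d) ^ e) := by
        gcongr
        rw [Finset.sum_const, Finset.card_range, nsmul_eq_mul]
        exact mul_le_mul_of_nonneg_right (by exact_mod_cast hJle) (by positivity)

/-! ### (34) from a linear-form bound `K d^θ M^{1−θ+η}` with `η < 2εθ` -/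

/-- **(34) for `ρ_h` from a power-saving linear-form bound of any shape (PROVED).**  Let
`f ∈ ℤ[X]`, `h ∈ ℤ` with `|ρ_h(n)| ≤ C τ(n)` (`n ≥ 1`), and suppose
`|L_d(M)| = |∑_{M<m≤2M} ρ_h(dm)| ≤ K d^θ M^{1−θ+η}` whenever `1 ≤ d ≤ M`, where `0 < θ ≤ 1`,
`0 ≤ η` and `η < 2εθ`, `0 < ε ≤ 1/2`.  Then hypothesis (34) of DFI's Theorem 5 holds for
`c_n = ρ_h(n)` at level `D = x^{1/2−ε}`: `|R(D)| ≤ A x (log x)^{−2}` for `x ≥ x₁`, uniformly in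
`|λ_d| ≤ 1`.  Indeed, as in [cite: DukeFriedlanderIwaniec1995, §7 p. 438] (there with
`θ = 1/20`, `η = ε'`): `|R(D)| ≤ ∑_{d<D} |S_d(⌊x⌋/d)| ≤ 2C D²(1 + log x)² + 2K x^{1−θ+η} D^{2θ} (1 + log x)²
≤ (2C + 2K) x^{1−σ} (1 + log x)²` with `σ = 2εθ − η > 0` (`D² = x^{1−2ε} ≤ x^{1−σ}` as `σ ≤ 2ε`),
and `4 (log x)⁴ ≤ x^σ` for large `x`.  (DFI: `θ = 1/20`; Tóth, positive discriminant:
`θ = 1/(4L)`, `η = 1/L²` [cite: Ngo2024, (1.3)]; Ngo: `θ = 1/13 + ε'`, `η = 2ε'`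
[cite: Ngo2024, Theorem 1.1].) [cite: DukeFriedlanderIwaniec1995, §7 p. 438 with (32), (34)] -/
theorem hyp34_of_linearFormBound {f : ℤ[X]} {h : ℤ} {Cρ K θ η ε : ℝ} (hCρ0 : 0 ≤ Cρ) (hK : 0 ≤ K)
    (hρ : ∀ n : ℕ, 1 ≤ n → ‖polyRootWeylSum f n h‖ ≤ Cρ * (Nat.divisors n).card)
    (hθ0 : 0 < θ) (hθ1 : θ ≤ 1) (hη0 : 0 ≤ η) (hε : 0 < ε) (hε2 : ε ≤ 1 / 2) (hηε : η < 2 * ε * θ)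
    (hL : ∀ d : ℕ, 1 ≤ d → ∀ M : ℝ, (d : ℝ) ≤ M →
      ‖linearForm f h d M‖ ≤ K * (d : ℝ) ^ θ * M ^ (1 - θ + η)) :
    Hyp34 f h ε := by
  -- the saving
  set σ : ℝ := 2 * ε * θ - η with hσ
  have hσ0 : 0 < σ := by rw [hσ]; linarith
  have hσ2ε : σ ≤ 2 * ε := by
    have : 2 * ε * θ ≤ 2 * ε * 1 := mul_le_mul_of_nonneg_left hθ1 (by linarith)
    rw [hσ]; linarith
  -- where the power saving beats the logarithms: `(log x)^4 ≤ x^σ/4` for `x ≥ x₂`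
  have hlo := (isLittleO_log_rpow_rpow_atTop (4 : ℝ) hσ0).bound (by norm_num : (0 : ℝ) < 1 / 4)
  obtain ⟨x₂, hx₂⟩ := Filter.eventually_atTop.1 hlo
  set A : ℝ := 2 * Cρ + 2 * K with hA
  refine ⟨max x₂ (Real.exp 2), A, fun x hx lam hlam => ?_⟩
  have hx₂x : x₂ ≤ x := (le_max_left _ _).trans hx
  have hxe : Real.exp 2 ≤ x := (le_max_right _ _).trans hx
  have hx4 : (4 : ℝ) ≤ x := by
    have h1 : (2 : ℝ) ≤ Real.exp 1 := by
      have := Real.add_one_le_exp (1 : ℝ); linarith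
    have h2 : Real.exp 2 = Real.exp 1 * Real.exp 1 := by rw [← Real.exp_add]; norm_num
    nlinarith
  have hx1 : (1 : ℝ) ≤ x := by linarith
  have hx0 : (0 : ℝ) < x := by linarith
  have hlogx : 2 ≤ Real.log x := by
    rw [← Real.log_exp 2]; exact Real.log_le_log (Real.exp_pos 2) hxe
  set D : ℝ := x ^ (1 / 2 - ε) with hDdef
  have hD1 : 1 ≤ D := Real.one_le_rpow hx1 (by linarith)
  have hD0 : 0 < D := by linarith
  have hDx : 2 * D ≤ x := by
    have hhalf : D ≤ x ^ (1 / 2 : ℝ) := Real.rpow_le_rpow_of_exponent_le hx1 (by linarith)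
    have hsq : x ^ (1 / 2 : ℝ) * x ^ (1 / 2 : ℝ) = x := by
      rw [← Real.rpow_add hx0]; norm_num
    have h2 : (2 : ℝ) ≤ x ^ (1 / 2 : ℝ) := by
      have : (4 : ℝ) ^ (1 / 2 : ℝ) ≤ x ^ (1 / 2 : ℝ) :=
        Real.rpow_le_rpow (by norm_num) hx4 (by norm_num)
      have h4 : (4 : ℝ) ^ (1 / 2 : ℝ) = 2 := by
        rw [show (4 : ℝ) = 2 ^ (2 : ℝ) by norm_num, ← Real.rpow_mul (by norm_num)]; norm_num
      linarith
    nlinarith [Real.rpow_nonneg hx0.le (1 / 2 : ℝ)]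
  have hDlex : D ≤ x := by linarith
  have hlog2D : Real.log (2 * D) ≤ Real.log x := Real.log_le_log (by linarith) hDx
  have hlx0 : 0 < Real.log x := by linarith
  have hD2 : D * D = x ^ (1 - 2 * ε) := by
    rw [hDdef, ← Real.rpow_add hx0]; ring_nf
  have hxD : x ^ (1 - θ + η) * D ^ (2 * θ) = x ^ (1 - σ) := by
    rw [hDdef, ← Real.rpow_mul hx0.le, ← Real.rpow_add hx0, hσ]; congr 1; ring
  have hD2le : x ^ (1 - 2 * ε) ≤ x ^ (1 - σ) :=
    Real.rpow_le_rpow_of_exponent_le hx1 (by linarith)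
  -- Step 1: `|R(D)| ≤ ∑_{d < D} |S_d(⌊x⌋/d)|`
  set F : Finset ℕ := (Icc 1 ⌊x⌋₊).filter (fun d : ℕ => (d : ℝ) < D) with hF
  have hFmem : ∀ d ∈ F, 1 ≤ d ∧ d ≤ ⌊x⌋₊ ∧ (d : ℝ) < D := fun d hd => by
    rw [hF, Finset.mem_filter, Finset.mem_Icc] at hd; exact ⟨hd.1.1, hd.1.2, hd.2⟩
  have step1 : ‖sieveR₁ (rhoSeq f h) lam x D‖ ≤
      ∑ d ∈ F, ‖partialSum f h d ((⌊x⌋₊ / d : ℕ) : ℝ)‖ := by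
    unfold sieveR₁
    refine (norm_sum_le _ _).trans (Finset.sum_le_sum fun d hd => ?_)
    rw [norm_mul]
    have hps : ∑ m ∈ Icc 1 (⌊x⌋₊ / d), rhoSeq f h (d * m) =
        partialSum f h d ((⌊x⌋₊ / d : ℕ) : ℝ) := by
      unfold partialSum; rw [Nat.floor_natCast]; rfl
    rw [hps]
    calc ‖lam d‖ * ‖partialSum f h d ((⌊x⌋₊ / d : ℕ) : ℝ)‖
        ≤ 1 * ‖partialSum f h d ((⌊x⌋₊ / d : ℕ) : ℝ)‖ :=
          mul_le_mul_of_nonneg_right (hlam d) (norm_nonneg _)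
      _ = _ := one_mul _
  -- Step 2: the inner bound, per `d`
  have he0 : 0 ≤ 1 - θ + η := by linarith
  have step2 : ∀ d ∈ F, ‖partialSum f h d ((⌊x⌋₊ / d : ℕ) : ℝ)‖ ≤
      Cρ * (2 * D * (1 + Real.log x)) * (Nat.divisors d).card +
        2 * Real.log x * (K * (x ^ (1 - σ) / d)) := by
    intro d hdF
    obtain ⟨hd, -, hdD⟩ := hFmem d hdF
    have hd1 : (1 : ℝ) ≤ d := by exact_mod_cast hd
    refine (norm_partialSum_floor_div_le_of_exponents hCρ0 hK he0 hρ hL hd hx1).trans ?_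
    gcongr ?_ + ?_
    · -- `Cρ τ(d) (2d)(1 + log 2d) ≤ Cρ (2D(1 + log x)) τ(d)`
      rw [mul_assoc, mul_assoc, mul_comm ((Nat.divisors d).card : ℝ)]
      refine mul_le_mul_of_nonneg_left (mul_le_mul_of_nonneg_right ?_ (Nat.cast_nonneg _)) hCρ0
      have h2d : ((2 * d : ℕ) : ℝ) ≤ 2 * D := by push_cast; linarith
      have h2d1 : (1 : ℝ) ≤ ((2 * d : ℕ) : ℝ) := by push_cast; linarith
      have hlog2d : Real.log ((2 * d : ℕ) : ℝ) ≤ Real.log x :=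
        (Real.log_le_log (by linarith) h2d).trans hlog2D
      have : 0 ≤ Real.log ((2 * d : ℕ) : ℝ) := Real.log_nonneg h2d1
      nlinarith
    · calc (Nat.log 2 ⌊x⌋₊ : ℝ) * (K * (d : ℝ) ^ θ * (x / d) ^ (1 - θ + η))
          = (Nat.log 2 ⌊x⌋₊ : ℝ) * (K * ((d : ℝ) ^ θ * (x / d) ^ (1 - θ + η))) := by
            ring
        _ ≤ 2 * Real.log x * (K * (x ^ (1 - θ + η) * D ^ (2 * θ) / d)) := by
            gcongr
            · exact natLog_two_floor_le hx1
            · exact rpow_mul_div_rpow_le_of_exponents hd1 hdD.le hx0 hθ0.le hη0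
        _ = 2 * Real.log x * (K * (x ^ (1 - σ) / d)) := by rw [hxD]
  -- Step 3: summing over `d < D`
  have hFsub1 : F ⊆ Icc 1 ⌊D⌋₊ := by
    intro d hd
    obtain ⟨h1, -, h3⟩ := hFmem d hd
    exact Finset.mem_Icc.2 ⟨h1, Nat.le_floor h3.le⟩
  have hFsub2 : F ⊆ Icc 1 ⌊x⌋₊ := Finset.filter_subset _ _
  have hτsum : ∑ d ∈ F, ((Nat.divisors d).card : ℝ) ≤ D * (1 + Real.log x) := by
    calc ∑ d ∈ F, ((Nat.divisors d).card : ℝ) ≤ ∑ d ∈ Icc 1 ⌊D⌋₊, ((Nat.divisors d).card : ℝ) :=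
          Finset.sum_le_sum_of_subset_of_nonneg hFsub1 fun _ _ _ => by positivity
      _ ≤ ⌊D⌋₊ * (1 + Real.log ⌊D⌋₊) := by
          have := Vaughan.sum_card_divisors_le ⌊D⌋₊
          rwa [Vaughan.Ioc_zero_eq_Icc_one] at this
      _ ≤ D * (1 + Real.log D) := natCast_mul_one_add_log_le (Nat.floor_le hD0.le) hD1
      _ ≤ D * (1 + Real.log x) := by
          have hlogD : Real.log D ≤ Real.log x := Real.log_le_log hD0 hDlex
          gcongr
  have hinvsum : ∑ d ∈ F, (x ^ (1 - σ) / d) ≤ x ^ (1 - σ) * (1 + Real.log x) := by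
    calc ∑ d ∈ F, (x ^ (1 - σ) / d) = x ^ (1 - σ) * ∑ d ∈ F, ((d : ℝ))⁻¹ := by
          rw [Finset.mul_sum]; exact Finset.sum_congr rfl fun d _ => by rw [div_eq_mul_inv]
      _ ≤ x ^ (1 - σ) * ∑ d ∈ Icc 1 ⌊x⌋₊, ((d : ℝ))⁻¹ :=
          mul_le_mul_of_nonneg_left
            (Finset.sum_le_sum_of_subset_of_nonneg hFsub2 fun _ _ _ => by positivity)
            (by positivity)
      _ ≤ x ^ (1 - σ) * (1 + Real.log ⌊x⌋₊) := by
          have h1 := Vaughan.sum_Ioc_inv_le ⌊x⌋₊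
          rw [Vaughan.Ioc_zero_eq_Icc_one] at h1
          exact mul_le_mul_of_nonneg_left h1 (by positivity)
      _ ≤ x ^ (1 - σ) * (1 + Real.log x) := by
          have h1 : Real.log (⌊x⌋₊ : ℝ) ≤ Real.log x :=
            Real.log_le_log (by exact_mod_cast Nat.floor_pos.2 hx1) (Nat.floor_le hx0.le)
          exact mul_le_mul_of_nonneg_left (by linarith) (by positivity)
  have step3 : ‖sieveR₁ (rhoSeq f h) lam x D‖ ≤
      A * x ^ (1 - σ) * (1 + Real.log x) ^ 2 := by
    refine step1.trans ((Finset.sum_le_sum step2).trans ?_)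
    rw [Finset.sum_add_distrib, ← Finset.mul_sum, ← Finset.mul_sum, ← Finset.mul_sum]
    have hl1 : 0 ≤ 1 + Real.log x := by linarith
    calc Cρ * (2 * D * (1 + Real.log x)) * ∑ d ∈ F, ((Nat.divisors d).card : ℝ) +
          2 * Real.log x * (K * ∑ d ∈ F, x ^ (1 - σ) / d)
        ≤ Cρ * (2 * D * (1 + Real.log x)) * (D * (1 + Real.log x)) +
          2 * Real.log x * (K * (x ^ (1 - σ) * (1 + Real.log x))) := by
          gcongr
      _ = 2 * Cρ * (D * D) * (1 + Real.log x) ^ 2 +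
          2 * K * x ^ (1 - σ) * (Real.log x * (1 + Real.log x)) := by ring
      _ ≤ 2 * Cρ * x ^ (1 - σ) * (1 + Real.log x) ^ 2 +
          2 * K * x ^ (1 - σ) * ((1 + Real.log x) * (1 + Real.log x)) := by
          rw [hD2]
          gcongr
          linarith
      _ = A * x ^ (1 - σ) * (1 + Real.log x) ^ 2 := by rw [hA]; ring
  -- Step 4: `x^{1−σ} (1 + log x)² ≤ x / (log x)²`
  have hsave : x ^ (1 - σ) * (1 + Real.log x) ^ 2 ≤ x / Real.log x ^ 2 := by
    have h4 : Real.log x ^ 4 ≤ x ^ σ / 4 := by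
      have := hx₂ x hx₂x
      rw [show (4 : ℝ) = ((4 : ℕ) : ℝ) by norm_num, Real.rpow_natCast,
        Real.norm_of_nonneg (by positivity), Real.norm_of_nonneg (by positivity)] at this
      linarith
    have hsplit : x = x ^ (1 - σ) * x ^ σ := by
      rw [← Real.rpow_add hx0]; ring_nf; exact (Real.rpow_one x).symm
    rw [le_div_iff₀ (by positivity)]
    have h1L : (1 + Real.log x) ^ 2 ≤ 4 * Real.log x ^ 2 := by nlinarith
    calc x ^ (1 - σ) * (1 + Real.log x) ^ 2 * Real.log x ^ 2
        ≤ x ^ (1 - σ) * (4 * Real.log x ^ 2) * Real.log x ^ 2 := by gcongr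
      _ = x ^ (1 - σ) * (4 * Real.log x ^ 4) := by ring
      _ ≤ x ^ (1 - σ) * x ^ σ := by
          refine mul_le_mul_of_nonneg_left (by linarith) (by positivity)
      _ = x := hsplit.symm
  have hA0 : 0 ≤ A := by rw [hA]; positivity
  calc ‖sieveR₁ (rhoSeq f h) lam x (x ^ (1 / 2 - ε))‖
      = ‖sieveR₁ (rhoSeq f h) lam x D‖ := by rw [hDdef]
    _ ≤ A * (x ^ (1 - σ) * (1 + Real.log x) ^ 2) := by rw [← mul_assoc]; exact step3
    _ ≤ A * (x / Real.log x ^ 2) := mul_le_mul_of_nonneg_left hsave hA0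
    _ = A * x / Real.log x ^ 2 := by ring

/-! ### The three printed shapes -/

/-- **(34) from DFI's shape, general `f`**: if for every `ε' > 0` there is `K` with
`|L_d(M)| ≤ K d^{1/20} M^{19/20+ε'}` for `1 ≤ d ≤ M` (the shape of
[cite: DukeFriedlanderIwaniec1995, Proposition 1 (9)] with `(h,d) ≤ h` absorbed), then (34) holds
for `c_n = ρ_h(n)` for every `0 < ε ≤ 1/2` (`θ = 1/20`, `η = ε' = ε/20`).  For
`f = aX² + 2bX + c`, `ac > b²` this is `DFI1995.hyp34_of_proposition1`.
[cite: DukeFriedlanderIwaniec1995, §7 p. 438] -/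
theorem hyp34_of_linearFormBound_dfi {f : ℤ[X]} {h : ℤ} {Cρ : ℝ} (hCρ0 : 0 ≤ Cρ)
    (hρ : ∀ n : ℕ, 1 ≤ n → ‖polyRootWeylSum f n h‖ ≤ Cρ * (Nat.divisors n).card)
    (h1 : ∀ ε' : ℝ, 0 < ε' → ∃ K : ℝ, ∀ d : ℕ, 1 ≤ d → ∀ M : ℝ, (d : ℝ) ≤ M →
      ‖linearForm f h d M‖ ≤ K * (d : ℝ) ^ (1 / 20 : ℝ) * M ^ (19 / 20 + ε'))
    {ε : ℝ} (hε : 0 < ε) (hε2 : ε ≤ 1 / 2) : Hyp34 f h ε := by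
  obtain ⟨K, hK⟩ := h1 (ε / 20) (by positivity)
  refine hyp34_of_linearFormBound (K := max K 0) (θ := 1 / 20) (η := ε / 20) hCρ0 (le_max_right _ _)
    hρ (by norm_num) (by norm_num) (by positivity) hε hε2 (by linarith) fun d hd M hdM => ?_
  have hM0 : 0 < M := lt_of_lt_of_le (by exact_mod_cast hd) hdM
  rw [show (1 - 1 / 20 + ε / 20 : ℝ) = 19 / 20 + ε / 20 by ring]
  refine (hK d hd M hdM).trans ?_
  have hnn : 0 ≤ (d : ℝ) ^ (1 / 20 : ℝ) * M ^ (19 / 20 + ε / 20) := by positivity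
  calc K * (d : ℝ) ^ (1 / 20 : ℝ) * M ^ (19 / 20 + ε / 20)
      = K * ((d : ℝ) ^ (1 / 20 : ℝ) * M ^ (19 / 20 + ε / 20)) := by ring
    _ ≤ max K 0 * ((d : ℝ) ^ (1 / 20 : ℝ) * M ^ (19 / 20 + ε / 20)) :=
        mul_le_mul_of_nonneg_right (le_max_left _ _) hnn
    _ = max K 0 * (d : ℝ) ^ (1 / 20 : ℝ) * M ^ (19 / 20 + ε / 20) := by ring

/-- **(34) from the shape of Tóth's bound (positive discriminant).**  Tóth's linear-form estimate,
in the form restated as [cite: Ngo2024, (1.3)]: for all sufficiently large natural `L`,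
`𝒲_h(x, N) = ∑_{x<n<2x, N∣n} ρ_h(n) ≪_h (N²/x)^{1/(4L)} (x/N)^{1+1/L²}`; with `N = d`, `x = dM`
this is `|L_d(M)| ≤ K_L (d/M)^{1/(4L)} M^{1+1/L²}` for `1 ≤ d ≤ M`.  If `ρ_h` satisfies a bound of
this shape (a HYPOTHESIS here — [cite: Toth2000, main theorem] is not vendored) and
`|ρ_h(n)| ≤ C τ(n)`, then (34) holds for `c_n = ρ_h(n)` for every `0 < ε ≤ 1/2`: choose
`L > 2/ε`, so that `η = 1/L² < 2ε · (1/(4L)) = 2εθ`, and apply `hyp34_of_linearFormBound`.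
[cite: Ngo2024, §1 (1.3)]; [cite: DukeFriedlanderIwaniec1995, §7 p. 438] -/
theorem hyp34_of_linearFormBound_toth {f : ℤ[X]} {h : ℤ} {Cρ : ℝ} (hCρ0 : 0 ≤ Cρ)
    (hρ : ∀ n : ℕ, 1 ≤ n → ‖polyRootWeylSum f n h‖ ≤ Cρ * (Nat.divisors n).card)
    (hT : ∃ L₀ : ℕ, ∀ L : ℕ, L₀ ≤ L → ∃ K : ℝ, ∀ d : ℕ, 1 ≤ d → ∀ M : ℝ, (d : ℝ) ≤ M →
      ‖linearForm f h d M‖ ≤ K * ((d : ℝ) / M) ^ (1 / (4 * (L : ℝ))) * M ^ (1 + 1 / (L : ℝ) ^ 2))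
    {ε : ℝ} (hε : 0 < ε) (hε2 : ε ≤ 1 / 2) : Hyp34 f h ε := by
  obtain ⟨L₀, hL₀⟩ := hT
  -- a natural `L ≥ L₀` with `L > 2/ε` (and `L ≥ 1`)
  set L : ℕ := max L₀ (⌈2 / ε⌉₊ + 1) with hLdef
  have hLL₀ : L₀ ≤ L := le_max_left _ _
  have hL2ε : 2 / ε < (L : ℝ) := by
    have h1 : (⌈2 / ε⌉₊ + 1 : ℕ) ≤ L := le_max_right _ _
    have h2 : 2 / ε ≤ (⌈2 / ε⌉₊ : ℝ) := Nat.le_ceil _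
    have h3 : ((⌈2 / ε⌉₊ + 1 : ℕ) : ℝ) ≤ (L : ℝ) := by exact_mod_cast h1
    push_cast at h3
    linarith
  have hL1 : (1 : ℝ) ≤ L := by
    have h1 : (⌈2 / ε⌉₊ + 1 : ℕ) ≤ L := le_max_right _ _
    have : 1 ≤ L := le_trans (by omega) h1
    exact_mod_cast this
  have hL0 : (0 : ℝ) < L := by linarith
  obtain ⟨K, hK⟩ := hL₀ L hLL₀
  set θ : ℝ := 1 / (4 * (L : ℝ)) with hθ
  set η : ℝ := 1 / (L : ℝ) ^ 2 with hη
  have hθ0 : 0 < θ := by rw [hθ]; positivity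
  have hθ1 : θ ≤ 1 := by
    rw [hθ, div_le_one (by positivity)]; linarith
  have hη0 : 0 ≤ η := by rw [hη]; positivity
  have hεL : 2 < ε * L := by
    have := (div_lt_iff₀ hε).1 hL2ε
    linarith
  have hηε : η < 2 * ε * θ := by
    rw [hη, hθ]
    rw [show 2 * ε * (1 / (4 * (L : ℝ))) = (ε / 2) / L by field_simp; ring]
    rw [div_lt_div_iff₀ (by positivity) hL0]
    rw [one_mul, sq]
    nlinarith
  refine hyp34_of_linearFormBound (K := max K 0) hCρ0 (le_max_right _ _) hρ hθ0 hθ1 hη0 hε hε2 hηε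
    fun d hd M hdM => ?_
  have hd0 : (0 : ℝ) < d := by exact_mod_cast hd
  have hM0 : 0 < M := lt_of_lt_of_le hd0 hdM
  refine (hK d hd M hdM).trans ?_
  -- `(d/M)^θ M^{1+η} = d^θ M^{1−θ+η}`
  have hconv : ((d : ℝ) / M) ^ θ * M ^ (1 + 1 / (L : ℝ) ^ 2) = (d : ℝ) ^ θ * M ^ (1 - θ + η) := by
    rw [Real.div_rpow hd0.le hM0.le, hη, div_mul_eq_mul_div, mul_div_assoc, ← Real.rpow_sub hM0]
    congr 2; ring
  have hnn : 0 ≤ (d : ℝ) ^ θ * M ^ (1 - θ + η) := by positivity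
  calc K * ((d : ℝ) / M) ^ (1 / (4 * (L : ℝ))) * M ^ (1 + 1 / (L : ℝ) ^ 2)
      = K * (((d : ℝ) / M) ^ θ * M ^ (1 + 1 / (L : ℝ) ^ 2)) := by rw [hθ]; ring
    _ = K * ((d : ℝ) ^ θ * M ^ (1 - θ + η)) := by rw [hconv]
    _ ≤ max K 0 * ((d : ℝ) ^ θ * M ^ (1 - θ + η)) := mul_le_mul_of_nonneg_right (le_max_left _ _) hnn
    _ = max K 0 * (d : ℝ) ^ θ * M ^ (1 - θ + η) := by ring

/-- **(34) from the shape of Ngo's Theorem 1.1 (positive discriminant).**  Ngo's estimate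
`𝒲_h(x, N) ≪_ε (x^{12/13} N^{−11/13} h^{1/13} + h) x^ε` [cite: Ngo2024, Theorem 1.1 (1.4)] reads,
with `N = d`, `x = dM` and the dependence on the fixed frequency `h` absorbed into the constant,
`|L_d(M)| ≤ K_{ε'} (d^{1/13} M^{12/13} + 1) (dM)^{ε'}` for all `ε' > 0`.  If `ρ_h` satisfies a
bound of this shape for `1 ≤ d ≤ M` (a HYPOTHESIS here) and `|ρ_h(n)| ≤ C τ(n)`, then (34) holds
for `c_n = ρ_h(n)` for every `0 < ε ≤ 1/2` (`ε' = ε/26`: `θ = 1/13 + ε'`, `η = 2ε' < 2εθ`).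
[cite: Ngo2024, Theorem 1.1]; [cite: DukeFriedlanderIwaniec1995, §7 p. 438] -/
theorem hyp34_of_linearFormBound_ngo {f : ℤ[X]} {h : ℤ} {Cρ : ℝ} (hCρ0 : 0 ≤ Cρ)
    (hρ : ∀ n : ℕ, 1 ≤ n → ‖polyRootWeylSum f n h‖ ≤ Cρ * (Nat.divisors n).card)
    (hN : ∀ ε' : ℝ, 0 < ε' → ∃ K : ℝ, ∀ d : ℕ, 1 ≤ d → ∀ M : ℝ, (d : ℝ) ≤ M →
      ‖linearForm f h d M‖ ≤
        K * ((d : ℝ) ^ (1 / 13 : ℝ) * M ^ (12 / 13 : ℝ) + 1) * ((d : ℝ) * M) ^ ε')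
    {ε : ℝ} (hε : 0 < ε) (hε2 : ε ≤ 1 / 2) : Hyp34 f h ε := by
  set ε' : ℝ := ε / 26 with hε'
  have hε'0 : 0 < ε' := by positivity
  obtain ⟨K, hK⟩ := hN ε' hε'0
  set θ : ℝ := 1 / 13 + ε' with hθ
  set η : ℝ := 2 * ε' with hη
  have hθ0 : 0 < θ := by rw [hθ]; positivity
  have hθ1 : θ ≤ 1 := by rw [hθ, hε']; linarith
  have hη0 : 0 ≤ η := by rw [hη]; positivity
  have hηε : η < 2 * ε * θ := by rw [hη, hθ, hε']; nlinarith
  refine hyp34_of_linearFormBound (K := 2 * max K 0) hCρ0 (by positivity) hρ hθ0 hθ1 hη0 hε hε2 hηε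
    fun d hd M hdM => ?_
  have hd1 : (1 : ℝ) ≤ d := by exact_mod_cast hd
  have hd0 : (0 : ℝ) < d := by linarith
  have hM1 : 1 ≤ M := le_trans hd1 hdM
  have hM0 : 0 < M := by linarith
  refine (hK d hd M hdM).trans ?_
  -- `(d^{1/13} M^{12/13} + 1)(dM)^{ε'} ≤ 2 d^{1/13+ε'} M^{12/13+ε'} = 2 d^θ M^{1−θ+η}`
  have hmain : ((d : ℝ) ^ (1 / 13 : ℝ) * M ^ (12 / 13 : ℝ) + 1) * ((d : ℝ) * M) ^ ε' ≤
      2 * ((d : ℝ) ^ θ * M ^ (1 - θ + η)) := by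
    have h1 : (1 : ℝ) ≤ (d : ℝ) ^ (1 / 13 : ℝ) * M ^ (12 / 13 : ℝ) :=
      one_le_mul_of_one_le_of_one_le (Real.one_le_rpow hd1 (by norm_num))
        (Real.one_le_rpow hM1 (by norm_num))
    have h2 : ((d : ℝ) ^ (1 / 13 : ℝ) * M ^ (12 / 13 : ℝ) + 1) ≤
        2 * ((d : ℝ) ^ (1 / 13 : ℝ) * M ^ (12 / 13 : ℝ)) := by linarith
    have h3 : (d : ℝ) ^ (1 / 13 : ℝ) * M ^ (12 / 13 : ℝ) * ((d : ℝ) * M) ^ ε' =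
        (d : ℝ) ^ θ * M ^ (1 - θ + η) := by
      rw [Real.mul_rpow hd0.le hM0.le, hθ, hη,
        show (1 - (1 / 13 + ε') + 2 * ε' : ℝ) = 12 / 13 + ε' by ring,
        Real.rpow_add hd0, Real.rpow_add hM0]
      ring
    have h4 : 0 ≤ ((d : ℝ) * M) ^ ε' := by positivity
    calc ((d : ℝ) ^ (1 / 13 : ℝ) * M ^ (12 / 13 : ℝ) + 1) * ((d : ℝ) * M) ^ ε'
        ≤ 2 * ((d : ℝ) ^ (1 / 13 : ℝ) * M ^ (12 / 13 : ℝ)) * ((d : ℝ) * M) ^ ε' :=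
          mul_le_mul_of_nonneg_right h2 h4
      _ = 2 * ((d : ℝ) ^ (1 / 13 : ℝ) * M ^ (12 / 13 : ℝ) * ((d : ℝ) * M) ^ ε') := by ring
      _ = 2 * ((d : ℝ) ^ θ * M ^ (1 - θ + η)) := by rw [h3]
  have hnn : 0 ≤ ((d : ℝ) ^ (1 / 13 : ℝ) * M ^ (12 / 13 : ℝ) + 1) * ((d : ℝ) * M) ^ ε' := by
    positivity
  calc K * ((d : ℝ) ^ (1 / 13 : ℝ) * M ^ (12 / 13 : ℝ) + 1) * ((d : ℝ) * M) ^ ε'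
      = K * (((d : ℝ) ^ (1 / 13 : ℝ) * M ^ (12 / 13 : ℝ) + 1) * ((d : ℝ) * M) ^ ε') := by ring
    _ ≤ max K 0 * (((d : ℝ) ^ (1 / 13 : ℝ) * M ^ (12 / 13 : ℝ) + 1) * ((d : ℝ) * M) ^ ε') :=
        mul_le_mul_of_nonneg_right (le_max_left _ _) hnn
    _ ≤ max K 0 * (2 * ((d : ℝ) ^ θ * M ^ (1 - θ + η))) :=
        mul_le_mul_of_nonneg_left hmain (le_max_right _ _)
    _ = 2 * max K 0 * (d : ℝ) ^ θ * M ^ (1 - θ + η) := by ring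

end DFI1995

/-! ### Tóth's theorem from a Tóth-shaped linear-form bound + (35) -/

/-- **Tóth's theorem from a Tóth-shaped linear-form bound and (35) (PROVED reduction).**  If, for
every irreducible quadratic `f ∈ ℤ[X]` of positive discriminant and every `h ≥ 1`, the linear forms
`L_d(M) = ∑_{M<m≤2M} ρ_h(dm)` satisfy, for all sufficiently large natural `L`,
`|L_d(M)| ≤ K (d/M)^{1/(4L)} M^{1+1/L²}` (`1 ≤ d ≤ M`; the shape of Tóth's estimate
[cite: Ngo2024, (1.3)]), and hypothesis (35) holds for `c_n = ρ_h(n)` (`0 < ε ≤ 1/12`), then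
`toth2000_quadraticRoots_primeModuli` holds: (34) by `DFI1995.hyp34_of_linearFormBound_toth` with
`|ρ_h(n)| ≤ C_f τ(n)` (`exists_norm_polyRootWeylSum_le_of_irreducible`), then
`toth2000_quadraticRoots_primeModuli_of_theorem5` with `dukeFriedlanderIwaniec1995_theorem5_holds`
(equivalently `toth2000_quadraticRoots_primeModuli_of_hyp34_hyp35` of
`PolynomialCongruencesPrimeModuliProofs.lean`).
[cite: Toth2000, main theorem]; [cite: Ngo2024, §1 (1.3)]; [cite: DukeFriedlanderIwaniec1995, §7] -/
theorem toth2000_quadraticRoots_primeModuli_of_tothLinearFormBound_of_hyp35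
    (HL : ∀ f : ℤ[X], f.natDegree = 2 → Irreducible f →
      0 < discrim (f.coeff 2) (f.coeff 1) (f.coeff 0) → ∀ h : ℕ, 1 ≤ h →
      ∃ L₀ : ℕ, ∀ L : ℕ, L₀ ≤ L → ∃ K : ℝ, ∀ d : ℕ, 1 ≤ d → ∀ M : ℝ, (d : ℝ) ≤ M →
        ‖DFI1995.linearForm f h d M‖ ≤
          K * ((d : ℝ) / M) ^ (1 / (4 * (L : ℝ))) * M ^ (1 + 1 / (L : ℝ) ^ 2))
    (H35 : ∀ f : ℤ[X], f.natDegree = 2 → Irreducible f →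
      0 < discrim (f.coeff 2) (f.coeff 1) (f.coeff 0) → ∀ h : ℕ, 1 ≤ h →
      ∀ ε : ℝ, 0 < ε → ε ≤ 1 / 12 → DFI1995.Hyp35 f h ε) :
    toth2000_quadraticRoots_primeModuli := by
  refine toth2000_quadraticRoots_primeModuli_of_theorem5 dukeFriedlanderIwaniec1995_theorem5_holds
    (fun f hf hirr hΔ h hh ε hε hε12 => ?_) H35
  obtain ⟨Cρ, hCρ, hρ⟩ := exists_norm_polyRootWeylSum_le_of_irreducible hf hirr
  exact DFI1995.hyp34_of_linearFormBound_toth (by linarith) (hρ h) (HL f hf hirr hΔ h hh) hε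
    (by linarith)

end Literature.NumberTheory.Sieve
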